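import Summits.CriticalPhenomena.CardyFormulaZ2.Theorems.CardySusyWardWeakHolomorphyComposition
import Summits.CriticalPhenomena.CardyFormulaZ2.Theorems.CardySusyWardWeakHolomorphyKirchhoffIdentity

/-!
# STRATEGY-CENSUS companion (crux `CardySusyWard.WeakHolomorphy`, stmt-CriticalPhenomena-11292)

Typed signatures for the census sections `## Decomposition` (D1) and `## Strengthen` (S2), with the
D1 glue PROVED: `OnceEnvelopeL1 → OnceRelativeChirality → OnceChiralityLawL1`, where
`OnceChiralityLawL1` is verbatim the registered stub `stub_onceChiralityLawL1` of the dead line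
`Sketch` (lead c1, skeleton v5), from which the crux follows by the landed bypass.  Nothing here is a
line: the census explains why this split wastes the crux's slack (the envelope is sharp-tight).
-/

noncomputable section

namespace Summit.CriticalPhenomena.CardyFormulaZ2.Cruxes.WeakHolomorphy.Census

open scoped BigOperators Topology
open Filter Set MeasureTheory Complex
open _root_.Literature.Probability.LatticeModels
open _root_.Literature.Probability.RandomPlanarGeometry (DobrushinDomain)
open _root_.Literature.Barriers.CriticalPhenomena (medialVertexOf)
open Summit.CriticalPhenomena.CardyFormulaZ2.Theorems.ParafermionPrecompact.Negative (IsFamily)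

/-- Shorthand: the once-visit chiral sum `Z_t(p)` at spin `σ`. [folklore] -/
def Z (Λ : ℝ → DiscreteDobrushin) (σ δ : ℝ) (p : Site 2 × Fin 2) (t : Bool) : ℂ :=
  onceChiralObs (Λ δ) δ σ (medialVertexOf p) t

/-- The registered stub `stub_onceChiralityLawL1` of line `Sketch` (verbatim): the `L¹` once-visit
chirality law. [folklore] -/
def OnceChiralityLawL1 : Prop :=
  ∀ (D : DobrushinDomain) (Λ : ℝ → DiscreteDobrushin), IsFamily D Λ → ∀ (K : Set ℂ), IsCompact K →
    K ⊆ D.carrier → ∀ ε > (0:ℝ), ∀ᶠ δ in 𝓝[>] (0:ℝ), ∀ S : Finset (Site 2 × Fin 2),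
      (∀ p ∈ S, medialPoint δ (medialVertexOf p) ∈ K) →
        ∑ p ∈ S, ‖onceKappa true * onceChiralObs (Λ δ) δ (1 / 3) (medialVertexOf p) true +
            onceKappa false * onceChiralObs (Λ δ) δ (1 / 3) (medialVertexOf p) false‖ ≤
          ε * δ ^ (-(5:ℝ) / 3)

/-- D1, piece 1 — the `L¹` once-visit ENVELOPE at the sharp scale `δ^{-5/3}` (two-arm mass `δ^{1/4}`
times the `δ^{1/12}` winding cancellation, summed over `δ^{-2}` vertices; zero slack). [folklore] -/
def OnceEnvelopeL1 : Prop :=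
  ∀ (D : DobrushinDomain) (Λ : ℝ → DiscreteDobrushin), IsFamily D Λ → ∀ (K : Set ℂ), IsCompact K →
    K ⊆ D.carrier → ∃ C : ℝ, ∀ᶠ δ in 𝓝[>] (0:ℝ), ∀ S : Finset (Site 2 × Fin 2),
      (∀ p ∈ S, medialPoint δ (medialVertexOf p) ∈ K) →
        ∑ p ∈ S, (‖Z Λ (1 / 3) δ p true‖ + ‖Z Λ (1 / 3) δ p false‖) ≤ C * δ ^ (-(5:ℝ) / 3)

/-- D1, piece 2 — the RELATIVE once-visit chirality law `Z_L = e^{iπ/6} Z_R (1 + o(1))`, pointwise and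
scale-free (the "30° datum"). [folklore] -/
def OnceRelativeChirality : Prop :=
  ∀ (D : DobrushinDomain) (Λ : ℝ → DiscreteDobrushin), IsFamily D Λ → ∀ (K : Set ℂ), IsCompact K →
    K ⊆ D.carrier → ∀ ε > (0:ℝ), ∀ᶠ δ in 𝓝[>] (0:ℝ), ∀ p : Site 2 × Fin 2,
      medialPoint δ (medialVertexOf p) ∈ K →
        ‖Z Λ (1 / 3) δ p true - Complex.exp ((Real.pi / 6 : ℝ) * Complex.I) * Z Λ (1 / 3) δ p false‖ ≤
          ε * (‖Z Λ (1 / 3) δ p true‖ + ‖Z Λ (1 / 3) δ p false‖)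

/-- S2 — the SPIN FAMILY of relative chirality laws (`s = 1/3` is D1 piece 2; `s = 0` is the turn
symmetry `P(once,L) ≈ P(once,R)` of the positive kernel): `Z^{(s)}_L = e^{isπ/2} Z^{(s)}_R (1+o(1))`.
[folklore] -/
def OnceRelativeChiralityAtSpin (s : ℝ) : Prop :=
  ∀ (D : DobrushinDomain) (Λ : ℝ → DiscreteDobrushin), IsFamily D Λ → ∀ (K : Set ℂ), IsCompact K →
    K ⊆ D.carrier → ∀ ε > (0:ℝ), ∀ᶠ δ in 𝓝[>] (0:ℝ), ∀ p : Site 2 × Fin 2,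
      medialPoint δ (medialVertexOf p) ∈ K →
        ‖Z Λ s δ p true - Complex.exp ((s * Real.pi / 2 : ℝ) * Complex.I) * Z Λ s δ p false‖ ≤
          ε * (‖Z Λ s δ p true‖ + ‖Z Λ s δ p false‖)

/-- `s = 1/3` of the spin family is D1 piece 2. [folklore] -/
theorem onceRelativeChiralityAtSpin_third :
    OnceRelativeChiralityAtSpin (1 / 3) ↔ OnceRelativeChirality := by
  have h : ((1 / 3 : ℝ) * Real.pi / 2 : ℝ) = (Real.pi / 6 : ℝ) := by ring
  unfold OnceRelativeChiralityAtSpin OnceRelativeChirality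
  simp only [h]

/-- The algebra of the two Kirchhoff constants: `κ_R = −κ_L · e^{iπ/6}` (no special value of the
phase is used beyond `e^{iπ/6} e^{-iπ/6} = 1`). [folklore] -/
theorem onceKappa_false_eq :
    onceKappa false = -onceKappa true * Complex.exp ((Real.pi / 6 : ℝ) * Complex.I) := by
  unfold onceKappa
  simp only [Bool.false_eq_true, ↓reduceIte, ite_true]
  set u := Complex.exp ((Real.pi / 6 : ℝ) * Complex.I) with hu
  set v := Complex.exp (-(Real.pi / 6 : ℝ) * Complex.I) with hv
  have huv : u * v = 1 := by
    rw [hu, hv, ← Complex.exp_add]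
    have : ((Real.pi / 6 : ℝ) : ℂ) * Complex.I + -((Real.pi / 6 : ℝ) : ℂ) * Complex.I = 0 := by ring
    rw [this, Complex.exp_zero]
  linear_combination (v - 2) * huv

/-- **D1 glue (proved).** Envelope × relative law ⇒ the registered `L¹` law. [folklore] -/
theorem onceChiralityLawL1_of (hEnv : OnceEnvelopeL1) (hRel : OnceRelativeChirality) :
    OnceChiralityLawL1 := by
  intro D Λ hΛ K hK hKD ε hε
  obtain ⟨C, hC⟩ := hEnv D Λ hΛ K hK hKD
  set kL : ℝ := ‖onceKappa true‖ with hkL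
  have hkL0 : 0 ≤ kL := norm_nonneg _
  set C' : ℝ := max C 1 with hC'
  have hC'pos : 0 < C' := lt_of_lt_of_le one_pos (le_max_right _ _)
  set ε₀ : ℝ := ε / (kL * C' + 1) with hε₀
  have hden : 0 < kL * C' + 1 := by positivity
  have hε₀pos : 0 < ε₀ := div_pos hε hden
  have hR := hRel D Λ hΛ K hK hKD ε₀ hε₀pos
  have hδpos : ∀ᶠ δ in 𝓝[>] (0:ℝ), 0 < δ := eventually_mem_nhdsWithin
  filter_upwards [hC, hR, hδpos] with δ hCδ hRδ hδ S hS
  have hrpow : 0 < δ ^ (-(5:ℝ) / 3) := Real.rpow_pos_of_pos hδ _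
  -- pointwise: ‖κ_L Z_L + κ_R Z_R‖ = ‖κ_L‖ ‖Z_L − e^{iπ/6} Z_R‖ ≤ ‖κ_L‖ ε₀ (‖Z_L‖ + ‖Z_R‖)
  have hpt : ∀ p ∈ S,
      ‖onceKappa true * onceChiralObs (Λ δ) δ (1 / 3) (medialVertexOf p) true +
          onceKappa false * onceChiralObs (Λ δ) δ (1 / 3) (medialVertexOf p) false‖ ≤
        kL * (ε₀ * (‖Z Λ (1 / 3) δ p true‖ + ‖Z Λ (1 / 3) δ p false‖)) := by
    intro p hp
    have hfac : onceKappa true * onceChiralObs (Λ δ) δ (1 / 3) (medialVertexOf p) true +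
          onceKappa false * onceChiralObs (Λ δ) δ (1 / 3) (medialVertexOf p) false =
        onceKappa true * (Z Λ (1 / 3) δ p true -
          Complex.exp ((Real.pi / 6 : ℝ) * Complex.I) * Z Λ (1 / 3) δ p false) := by
      rw [onceKappa_false_eq]; unfold Z; ring
    rw [hfac, norm_mul]
    exact mul_le_mul_of_nonneg_left (hRδ p (hS p hp)) hkL0
  calc ∑ p ∈ S, ‖onceKappa true * onceChiralObs (Λ δ) δ (1 / 3) (medialVertexOf p) true +
            onceKappa false * onceChiralObs (Λ δ) δ (1 / 3) (medialVertexOf p) false‖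
      ≤ ∑ p ∈ S, kL * (ε₀ * (‖Z Λ (1 / 3) δ p true‖ + ‖Z Λ (1 / 3) δ p false‖)) :=
        Finset.sum_le_sum hpt
    _ = kL * ε₀ * ∑ p ∈ S, (‖Z Λ (1 / 3) δ p true‖ + ‖Z Λ (1 / 3) δ p false‖) := by
        rw [Finset.mul_sum]; refine Finset.sum_congr rfl fun p _ => by ring
    _ ≤ kL * ε₀ * (C' * δ ^ (-(5:ℝ) / 3)) := by
        apply mul_le_mul_of_nonneg_left _ (by positivity)
        exact (hCδ S hS).trans (mul_le_mul_of_nonneg_right (le_max_left _ _) hrpow.le)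
    _ = (kL * C' / (kL * C' + 1)) * ε * δ ^ (-(5:ℝ) / 3) := by rw [hε₀]; ring
    _ ≤ 1 * ε * δ ^ (-(5:ℝ) / 3) := by
        apply mul_le_mul_of_nonneg_right _ hrpow.le
        apply mul_le_mul_of_nonneg_right _ hε.le
        rw [div_le_one hden]; linarith
    _ = ε * δ ^ (-(5:ℝ) / 3) := by ring

end Summit.CriticalPhenomena.CardyFormulaZ2.Cruxes.WeakHolomorphy.Census

end
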